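import Summits.CriticalPhenomena.PercolationContinuityZ3.Theorems.PercNearOneGluingNoHeavyLowerTailSahiParamLayer
import Summits.CriticalPhenomena.PercolationContinuityZ3.Theorems.SahiConjectureUniform

/-!
# `NoHeavyLowerTail` (crux stmt-CriticalPhenomena-4575), Sahi programme P1: the TENSOR-LIFT REDUCTION —
# Sahi's `C_3` (⟺ Kahn's Conjecture 5 ⟺ Lieb–Sahi at `n = 3`) follows from ONE implication on the 27-point lattice `[3]³`

Support file (Sahi cell, seat `prim-sahi-p1`, generation 5; `--supports stmt-CriticalPhenomena-4575`).  Pure proofs, no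
definitions, standard axioms; nothing open is asserted — the 27-point statement is a HYPOTHESIS.

TENSOR LIFT.  For a finite preorder `L` with a probability weight `m` and the fair coin on `Bool`, the LIFTED weight on `Bool × L`
is `(t, x) ↦ m(x)/2`.  An up-set of `Bool × L` is a nested pair `A₀ ⊆ A₁` of up-sets of `L` (its sections at `false` and
`true`), and the monotone LEVEL MAP `x ↦ (#{A_i ∋ x}, #{B_i ∋ x}, #{C_i ∋ x}) ∈ [3]³` turns any triple of up-sets of `Bool × L`
into the three COORDINATE pairs `{y_i = 2} ⊆ {y_i ≥ 1}` of `Bool × [3]³` under the pushed-forward weight, which is again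
Sahi-positive (`SahiPositive.of_pushWeight`).  Hence (`sahiPositive_lift_of_coord27`):

  (TL27)  for every probability weight `m` on `[3]³ = (Fin 3 → Fin 3)` that is Sahi-positive at order 3, `E_3 ≥ 0` for the
          three coordinate two-layer indicators under `(t, y) ↦ m(y)/2`
  ⟹  for EVERY finite preorder `L` and every probability weight `m` on `L`: `SahiPositive m 3 → SahiPositive (lift m) 3`.

INDUCTION.  The fair-coin weight on `{0,1}^{M+1}` is the lift of the one on `{0,1}^M` along `Fin.consOrderIso`; so (TL27) gives
Sahi positivity at order 3 of every uniform cube (`sahiPositive_uniformWeight_of_lift`), hence — by the tree's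
`sahiConjecture_iff_forall_uniformWeight_fin` (dyadic coins are monotone images of fair coins; continuity in the weight) and
`sahiConjecture_three_iff_kahnConjecture` — `SahiConjecture 3` and `KahnConjecture` (`sahiConjecture_three_of_coord27`,
`kahnConjecture_of_coord27`).  THE UPSHOT: Sahi's third-order conjecture for ALL finite distributive lattices and ALL FKG
weights is implied by a single implication between cubic forms in the 27 point masses of `[3]³` (hypothesis: the 980·981·982/6
inequalities `E_3(1_U,1_V,1_W) ≥ 0` over up-sets of `[3]³`; conclusion: one cubic inequality).  The identity behind it (this
programme, PROOF-C3 §17(d)): with `f = (1_{A₀} + 1_{A₁})/2` etc. and `ΔA = A₁ ∖ A₀`,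
  `E_3^{lift}(Â,B̂,Ĉ) = E_3^m(f,g,h) + ¼·[3 m(ΔA∩ΔB∩ΔC) + 2 Σ_cyc m(A₀∩ΔB∩ΔC) − Σ_cyc E(f)·m(ΔB∩ΔC)]`.
Numerically (kit, this seat) the 27-point implication holds on every tested sub-instance and has degree-3 linear
certificates on the small analogues `L = 2²` (1540/1540 lifted triples) and `L = [2]×[3]` (22100/22100); see PROOF-C3 §17.
New mathematics; standard ingredients.
-/

namespace Summit.CriticalPhenomena.PercolationContinuityZ3.Theorems.SahiLayer

open Finset Function Literature.Combinatorics.Sahi2008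
open scoped BigOperators

noncomputable section

/-! ## The level-map reduction -/

section Reduction

/-- **TENSOR LIFT FROM THE 27-POINT STATEMENT.**  If for every order-3 Sahi-positive probability weight `m` on `[3]³` the three
coordinate two-layer indicators have `E_3 ≥ 0` under the lifted weight `(t,y) ↦ m(y)/2`, then for EVERY finite preorder `L`
and every order-3 Sahi-positive probability weight `m` on `L` the lifted weight `(t,x) ↦ m(x)/2` on `Bool × L` is Sahi-positive
at order 3 (layer cake; level map `L → [3]³`; push-forward). [this work] -/
theorem sahiPositive_lift_of_coord27
    (H27 : ∀ m : (Fin 3 → Fin 3) → ℝ, (∀ y, 0 ≤ m y) → ∑ y, m y = 1 → SahiPositive m 3 →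
      0 ≤ sahiE (fun x : Bool × (Fin 3 → Fin 3) => (1 / 2 : ℝ) * m x.2) 3
        (fun i x => if x.1 = true then (if (1 : Fin 3) ≤ x.2 i then (1 : ℝ) else 0)
          else (if x.2 i = 2 then (1 : ℝ) else 0)))
    {L : Type*} [Preorder L] [Fintype L] [DecidableEq L] {m : L → ℝ} (hm0 : ∀ x, 0 ≤ m x)
    (hm1 : ∑ x, m x = 1) (h : SahiPositive m 3) :
    SahiPositive (fun x : Bool × L => (1 / 2 : ℝ) * m x.2) 3 := by
  classical
  rw [sahiPositive_iff_indicators]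
  intro U hU
  -- sections: `(false, x) ∈ U i` ⟹ `(true, x) ∈ U i`
  have h01 : ∀ i x, (false, x) ∈ U i → (true, x) ∈ U i := fun i x hx =>
    hU i (show ((false, x) : Bool × L) ≤ (true, x) from ⟨Bool.false_le _, le_rfl⟩) hx
  have hmono0 : ∀ i x y, x ≤ y → (false, x) ∈ U i → (false, y) ∈ U i := fun i x y hxy hx =>
    hU i (show ((false, x) : Bool × L) ≤ (false, y) from ⟨le_rfl, hxy⟩) hx
  have hmono1 : ∀ i x y, x ≤ y → (true, x) ∈ U i → (true, y) ∈ U i := fun i x y hxy hx =>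
    hU i (show ((true, x) : Bool × L) ≤ (true, y) from ⟨le_rfl, hxy⟩) hx
  -- the level map
  obtain ⟨ℓ, hℓ⟩ : ∃ ℓ : L → (Fin 3 → Fin 3),
      ℓ = fun x i => if (false, x) ∈ U i then 2 else if (true, x) ∈ U i then 1 else 0 := ⟨_, rfl⟩
  have hℓ2 : ∀ x i, ℓ x i = 2 ↔ (false, x) ∈ U i := by
    intro x i
    rw [hℓ]
    by_cases h0 : (false, x) ∈ U i
    · simp only [h0, if_true]
    · by_cases h1 : (true, x) ∈ U i
      · simp only [h0, h1, if_false, if_true, iff_false]; decide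
      · simp only [h0, h1, if_false, iff_false]; decide
  have hℓ1 : ∀ x i, (1 : Fin 3) ≤ ℓ x i ↔ (true, x) ∈ U i := by
    intro x i
    rw [hℓ]
    by_cases h0 : (false, x) ∈ U i
    · simp only [h0, if_true, h01 i x h0, iff_true]; decide
    · by_cases h1 : (true, x) ∈ U i
      · simp only [h0, h1, if_false, if_true, iff_true]; decide
      · simp only [h0, h1, if_false, iff_false]; decide
  have hℓmono : Monotone ℓ := by
    intro x y hxy i
    by_cases h0y : (false, y) ∈ U i
    · rw [(hℓ2 y i).2 h0y]
      exact Fin.le_last _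
    · have h0x : (false, x) ∉ U i := fun hx => h0y (hmono0 i x y hxy hx)
      by_cases h1y : (true, y) ∈ U i
      · have hy1 : (1 : Fin 3) ≤ ℓ y i := (hℓ1 y i).2 h1y
        by_cases h1x : (true, x) ∈ U i
        · -- both levels are exactly 1
          have hx : ℓ x i = 1 := by
            rw [hℓ]; simp only [h0x, h1x, if_false, if_true]
          have hy : ℓ y i = 1 := by
            rw [hℓ]; simp only [h0y, h1y, if_false, if_true]
          rw [hx, hy]
        · have hx : ℓ x i = 0 := by
            rw [hℓ]; simp only [h0x, h1x, if_false]
          rw [hx]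
          exact Fin.zero_le _
      · have h1x : (true, x) ∉ U i := fun hx => h1y (hmono1 i x y hxy hx)
        have hx : ℓ x i = 0 := by
          rw [hℓ]; simp only [h0x, h1x, if_false]
        have hy : ℓ y i = 0 := by
          rw [hℓ]; simp only [h0y, h1y, if_false]
        rw [hx, hy]
  have hGmono : Monotone (fun x : Bool × L => ((x.1, ℓ x.2) : Bool × (Fin 3 → Fin 3))) :=
    fun x y hxy => ⟨hxy.1, hℓmono hxy.2⟩
  -- the indicators are the coordinate two-layer indicators pulled back along `G = id × ℓ`
  have hind : (fun i => setInd (U i)) = fun i => (fun x : Bool × (Fin 3 → Fin 3) =>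
      if x.1 = true then (if (1 : Fin 3) ≤ x.2 i then (1 : ℝ) else 0) else (if x.2 i = 2 then (1 : ℝ) else 0)) ∘
        (fun x : Bool × L => ((x.1, ℓ x.2) : Bool × (Fin 3 → Fin 3))) := by
    funext i x
    obtain ⟨t, x⟩ := x
    rw [Function.comp_apply, setInd_apply]
    cases t
    · simp only [Bool.false_eq_true, if_false]
      by_cases hx : (false, x) ∈ U i
      · rw [if_pos hx, if_pos ((hℓ2 x i).2 hx)]
      · rw [if_neg hx, if_neg (fun h => hx ((hℓ2 x i).1 h))]
    · simp only [if_true]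
      by_cases hx : (true, x) ∈ U i
      · rw [if_pos hx, if_pos ((hℓ1 x i).2 hx)]
      · rw [if_neg hx, if_neg (fun h => hx ((hℓ1 x i).1 h))]
  rw [hind, ← sahiE_pushWeight]
  -- the push-forward of the lifted weight is the lift of the push-forward
  have hpush : pushWeight (fun x : Bool × L => (1 / 2 : ℝ) * m x.2)
      (fun x : Bool × L => ((x.1, ℓ x.2) : Bool × (Fin 3 → Fin 3))) =
      fun z : Bool × (Fin 3 → Fin 3) => (1 / 2 : ℝ) * pushWeight m ℓ z.2 :=
    pushWeight_id_prodMap (T := Bool) (fun _ : Bool => (1 / 2 : ℝ)) m ℓ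
  rw [hpush]
  exact H27 _ (fun y => pushWeight_nonneg hm0 ℓ y) (by rw [sum_pushWeight, hm1]) (h.of_pushWeight hℓmono)

end Reduction

/-! ## The induction over the uniform cubes -/

section Induction

/-- **Fair coins, one at a time**: if lifting by a fair coin preserves order-3 Sahi positivity (for all finite preorders in
`Type`), then the uniform weight on every cube `{0,1}^M` is Sahi-positive at order 3 (induction on `M` along
`Fin.consOrderIso`). [this work] -/
theorem sahiPositive_uniformWeight_of_lift
    (HL : ∀ (L : Type) [Preorder L] [Fintype L] [DecidableEq L] (m : L → ℝ), (∀ x, 0 ≤ m x) → ∑ x, m x = 1 →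
      SahiPositive m 3 → SahiPositive (fun x : Bool × L => (1 / 2 : ℝ) * m x.2) 3) :
    ∀ M : ℕ, SahiPositive (uniformWeight (Fin M)) 3
  | 0 => by
      classical
      rw [sahiPositive_iff_indicators]
      intro U _
      refine sahiE_setInd_nonneg_of_total (fun y => by rw [uniformWeight_apply]; positivity)
        isFKGMeasure_uniformWeight.sum_eq_one U fun i j => ?_
      -- on the one-point cube any two finsets are comparable
      by_cases hi : (U i).Nonempty
      · right
        intro y _
        obtain ⟨z, hz⟩ := hi
        rwa [Subsingleton.elim y z]
      · left
        rw [not_nonempty_iff_eq_empty.1 hi]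
        exact empty_subset _
  | M + 1 => by
      classical
      have ih := sahiPositive_uniformWeight_of_lift HL M
      have hlift := HL (Fin M → Bool) (uniformWeight (Fin M)) (fun y => by rw [uniformWeight_apply]; positivity)
        isFKGMeasure_uniformWeight.sum_eq_one ih
      obtain ⟨e, he⟩ : ∃ e : Bool × (Fin M → Bool) ≃o (Fin (M + 1) → Bool), e = Fin.consOrderIso fun _ => Bool :=
        ⟨_, rfl⟩
      have hpush : pushWeight (fun x : Bool × (Fin M → Bool) => (1 / 2 : ℝ) * uniformWeight (Fin M) x.2) e =
          uniformWeight (Fin (M + 1)) := by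
        funext y
        rw [show (e : Bool × (Fin M → Bool) → (Fin (M + 1) → Bool)) = e.toEquiv from rfl, pushWeight_equiv,
          uniformWeight_apply, uniformWeight_apply, Fintype.card_fin, Fintype.card_fin, pow_succ]
        ring
      rw [← hpush]
      exact hlift.of_pushWeight e.monotone

/-- **SAHI'S `C_3` FROM THE 27-POINT STATEMENT.**  (TL27) ⟹ `SahiConjecture 3`: Sahi's third-order correlation conjecture
(= Lieb–Sahi's Conjecture 1.1 at `n = 3`) for every FKG probability weight on every finite distributive lattice.
[this work] -/
theorem sahiConjecture_three_of_coord27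
    (H27 : ∀ m : (Fin 3 → Fin 3) → ℝ, (∀ y, 0 ≤ m y) → ∑ y, m y = 1 → SahiPositive m 3 →
      0 ≤ sahiE (fun x : Bool × (Fin 3 → Fin 3) => (1 / 2 : ℝ) * m x.2) 3
        (fun i x => if x.1 = true then (if (1 : Fin 3) ≤ x.2 i then (1 : ℝ) else 0)
          else (if x.2 i = 2 then (1 : ℝ) else 0))) :
    SahiConjecture 3 :=
  (sahiConjecture_iff_forall_uniformWeight_fin 3).2
    (sahiPositive_uniformWeight_of_lift fun _ _ _ _ _ hm0 hm1 h => sahiPositive_lift_of_coord27 H27 hm0 hm1 h)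

/-- **KAHN'S CONJECTURE 5 FROM THE 27-POINT STATEMENT.** [this work] -/
theorem kahnConjecture_of_coord27
    (H27 : ∀ m : (Fin 3 → Fin 3) → ℝ, (∀ y, 0 ≤ m y) → ∑ y, m y = 1 → SahiPositive m 3 →
      0 ≤ sahiE (fun x : Bool × (Fin 3 → Fin 3) => (1 / 2 : ℝ) * m x.2) 3
        (fun i x => if x.1 = true then (if (1 : Fin 3) ≤ x.2 i then (1 : ℝ) else 0)
          else (if x.2 i = 2 then (1 : ℝ) else 0))) :
    KahnConjecture :=
  sahiConjecture_three_iff_kahnConjecture.1 (sahiConjecture_three_of_coord27 H27)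

end Induction

end

end Summit.CriticalPhenomena.PercolationContinuityZ3.Theorems.SahiLayer
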